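import Literature.Barriers.AnomalousDissipation.ShearFlowViscositySelectionTransport
import Literature.Analysis.FunctionSpaces.TorusFourierCalculus
import Literature.Analysis.FunctionSpaces.TorusAxisAverage
import HarnessLib

/-!
# Bardos–Titi–Wiedemann 2012, Lemma 4 — uniqueness, part 1: twisted characters as test fields

Towards the **uniqueness conjunct** of the named fact `BardosTitiWiedemann2012_lemma4`
(`Literature/Barriers/AnomalousDissipation/ShearFlowViscositySelectionLimit.lean`; Bardos–Titi–
Wiedemann, C. R. Math. 350 (2012), Lemma 4: the weak solution of `∂ₜw + v(x₂)∂_{x₁}w = 0`,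
`w(0) = w₀`, `v ∈ L²(T)`, `w₀ ∈ L²(T²)`, "is unique in the class `L^∞((0,T);L²(T²))`. We omit
the elementary proof of the Lemma"; the existence conjunct is proved in the sibling
`ShearFlowViscositySelectionTransport.lean`). The velocity field `(v(x₂), 0)` is divergence
free but only `L²`, outside the DiPerna–Lions class `W^{1,1}`, so uniqueness is not the general
theory but the explicit integrability of this field: its flow is the shear
`(x₁, x₂) ↦ (x₁ + s v(x₂), x₂)`, and a test function transported by the flow turns the weak
formulation into `∂ₛ` of the solution read along the characteristics.

The elementary proof formalised in this series: test the weak formulation against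
`χ(s) e_{-k}(x₁ - s c(x₂), x₂)` — the character `e_{-k}` of `T²` transported along the
characteristics of a *smooth* profile `c ≈ v` — i.e. against the real and imaginary parts of
the **twisted test field** `Ψ(s,x) = χ(s) E_{k,c}(s,x)`, `E_{k,c}(s,x) = e_{k₁}(s c(x)) e_{-k}(x)`
(this file); let `c → v(x₂)` in `L²` (next file) to obtain
`∫₀ᵀ χ'(s) 𝓕[w(s) ∘ σ_s](k) ds = -χ(0) ŵ₀(k)` with `σ_s` the shear by `s v`, whence
`𝓕[w(s) ∘ σ_s](k) = ŵ₀(k)` for a.e. `s` (du Bois-Reymond with datum,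
`Literature.Analysis.FunctionSpaces.ae_eq_exp_smul_of_forall_integral_deriv_sub`), so
`w(s) ∘ σ_s = w₀` a.e. by uniqueness of Fourier coefficients, i.e. `w` is the shear transport.

## This file

* circle characters: `‖e_n‖ = 1`, smoothness and derivative of `r ↦ e_n(r)`, the Lipschitz
  bound `‖e_n(a) - e_n(b)‖ ≤ 2π|n||a-b|`;
* `twistChar k c s x`, `twistTest χ k c` and their algebra: unimodularity, value at `s = 0`,
  Lipschitz dependence on the profile, and `e_{-k}(x₁ - s v(x₂), x₂) = E_{k,v(x₂)}(s,x)`;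
* smoothness: the space–time lift of `Ψ` is `C^∞`, so `Re Ψ`, `Im Ψ` are space–time test
  fields on `T² × [0,T)` when `χ` vanishes near `T` (`isSpaceTimeTest_twistTest_re/im`);
* derivatives: `∂ₛΨ = (χ' + χ·2πik₁c)E`, and, for `c` independent of `x₁`,
  `∂₁Ψ = -2πik₁Ψ`; hence **the transport identity**
  `(∂ₛ + v(x₂)∂₁) Re Ψ = Re[(χ' + χ·2πik₁(c - v(x₂)))E]` (`transport_twistTest_re`, `_im`),
  written as the integrand of the accepted `Torus.IsWeakScalarTransportOn` for
  `shearVelocity v`.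

## References

* C. Bardos, E. S. Titi, E. Wiedemann, C. R. Math. Acad. Sci. Paris 350 (2012) 757–760, Lemma 4
  (`BardosTitiWiedemann2012`).
* R. J. DiPerna, P.-L. Lions, Invent. Math. 98 (1989) 511–547, §II.1, §III.1 (weak solutions of
  transport equations, transport of test functions by the flow) (`DiPernaLions1989`).
* L. Grafakos, *Classical Fourier Analysis*, 3rd ed. (2014), §3.1.1 (characters of `Tⁿ`)
  (`Grafakos2014`).
-/

open MeasureTheory Set Filter Topology Function UnitAddTorus Complex
open scoped ENNReal NNReal InnerProductSpace ContDiff Real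

noncomputable section

namespace Literature.Barriers.AnomalousDissipation

/-- The flat two-torus `T² = (ℝ/ℤ)²` (local notation). -/
local notation "𝕋²" => UnitAddTorus (Fin 2)

/-! ## Characters of the circle: norms, smoothness, a Lipschitz bound -/

/-- The characters of the circle are unimodular: `‖e_n(a)‖ = 1`. [folklore] -/
theorem norm_fourier_apply (n : ℤ) (a : UnitAddCircle) : ‖fourier n a‖ = 1 := by
  rw [fourier_apply]
  exact Circle.norm_coe _

/-- `e_n(r) = exp(i · 2π n r)` on `T = ℝ/ℤ` (Mathlib's `fourier_coe_apply` with period `1`). [folklore] -/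
theorem fourier_coe_eq_exp (n : ℤ) (r : ℝ) :
    fourier n (r : UnitAddCircle) = Complex.exp (Complex.I * ((2 * π * n * r : ℝ) : ℂ)) := by
  rw [fourier_coe_apply]
  congr 1
  push_cast
  ring

/-- `r ↦ e_n(r)` is smooth on `ℝ`. [folklore] -/
theorem contDiff_fourier_coe (n : ℤ) : ContDiff ℝ ∞ fun r : ℝ => fourier n (r : UnitAddCircle) := by
  have h : (fun r : ℝ => fourier n (r : UnitAddCircle)) =
      fun r : ℝ => Complex.exp (Complex.I * ((2 * π * n * r : ℝ) : ℂ)) := funext (fourier_coe_eq_exp n)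
  rw [h]
  refine Complex.contDiff_exp.comp (contDiff_const.mul ?_)
  exact Complex.ofRealCLM.contDiff.comp (contDiff_const.mul contDiff_id)

/-- **The characters are Lipschitz in the argument**: `‖e_n(a) - e_n(b)‖ ≤ 2π|n||a - b|`
(`e_n(a) - e_n(b) = e_n(b)(e_n(a-b) - 1)` and `‖e^{ix} - 1‖ ≤ |x|`). [folklore] -/
theorem norm_fourier_coe_sub_le (n : ℤ) (a b : ℝ) :
    ‖fourier n (a : UnitAddCircle) - fourier n (b : UnitAddCircle)‖ ≤ 2 * π * |(n : ℝ)| * |a - b| := by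
  have hsplit : fourier n (a : UnitAddCircle) =
      fourier n (b : UnitAddCircle) * fourier n ((a - b : ℝ) : UnitAddCircle) := by
    rw [← Literature.Analysis.FunctionSpaces.Torus.fourier_apply_add, ← AddCircle.coe_add, add_sub_cancel]
  rw [hsplit, ← mul_sub_one, norm_mul, norm_fourier_apply, one_mul, fourier_coe_eq_exp]
  refine (Real.norm_exp_I_mul_ofReal_sub_one_le).trans (le_of_eq ?_)
  rw [Real.norm_eq_abs, abs_mul, abs_mul, abs_mul, abs_of_nonneg (by positivity : (0 : ℝ) ≤ 2),
    abs_of_nonneg Real.pi_pos.le]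


/-- `e_n(0 · r) = 1`. [folklore] -/
theorem fourier_eval_coe_zero_mul (n : ℤ) (r : ℝ) : fourier n (((0 : ℝ) * r : ℝ) : UnitAddCircle) = 1 := by
  rw [zero_mul, QuotientAddGroup.mk_zero, fourier_eval_zero]

/-- `e_{-n}(-a) = e_n(a)`. [folklore] -/
theorem fourier_neg_neg (n : ℤ) (a : UnitAddCircle) : fourier (-n) (-a) = fourier n a := by
  simp only [fourier_apply, neg_zsmul, zsmul_neg, neg_neg]

/-- `d/dr e_n(r) = 2πi n e_n(r)` on `T = ℝ/ℤ` (Mathlib's `hasDerivAt_fourier` with period `1`). [folklore] -/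
theorem hasDerivAt_fourier_coe (n : ℤ) (r : ℝ) :
    HasDerivAt (fun y : ℝ => fourier n (y : UnitAddCircle))
      (2 * π * I * n * fourier n (r : UnitAddCircle)) r := by
  have h := hasDerivAt_fourier 1 n r
  simp only [Complex.ofReal_one, div_one] at h
  exact h

/-! ## The twisted characters -/

/-- **The twisted character** `E_{k,c}(s, x) = e_{k₁}(s c(x)) e_{-k}(x)
= exp(2πi k₁ s c(x)) e^{-2πi k·x}` on `T²` (`k ∈ ℤ²`, profile `c : T² → ℝ`, time `s`): the
character `e_{-k}` transported along the characteristics `s ↦ (x₁ + s c(x), x₂)` of the field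
`(c(x), 0)` — for `c(x) = v(x₂)`, `E_{k,c}(s, x) = e_{-k}(x₁ - s v(x₂), x₂)`
(`mFourier_neg_apply_skew`). Testing the transport equation of Lemma 4 against
`χ(s) E_{k,c}(s,x)` with smooth `c ≈ v(x₂)` is the method of characteristics in weak form
(Bardos–Titi–Wiedemann 2012, Lemma 4, "elementary proof" omitted there; DiPerna–Lions 1989,
§II.1, test functions transported by the flow). [folklore] -/
def twistChar (k : Fin 2 → ℤ) (c : 𝕋² → ℝ) (s : ℝ) (x : 𝕋²) : ℂ :=
  fourier (k 0) ((s * c x : ℝ) : UnitAddCircle) * mFourier (-k) x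

/-- **The twisted test field** `Ψ(s, x) = χ(s) E_{k,c}(s, x)` (complex valued; its real and
imaginary parts are the real space–time test functions actually fed to the weak formulation),
for a time profile `χ : ℝ → ℝ`. [folklore] -/
def twistTest (χ : ℝ → ℝ) (k : Fin 2 → ℤ) (c : 𝕋² → ℝ) : ℝ → 𝕋² → ℂ :=
  fun s x => (χ s : ℂ) * twistChar k c s x

/-- The twisted characters are unimodular. [folklore] -/
theorem norm_twistChar (k : Fin 2 → ℤ) (c : 𝕋² → ℝ) (s : ℝ) (x : 𝕋²) : ‖twistChar k c s x‖ = 1 := by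
  rw [twistChar, norm_mul, norm_fourier_apply, Literature.Analysis.FunctionSpaces.Torus.norm_mFourier_apply,
    one_mul]

/-- At `s = 0` the twisted character is the character `e_{-k}`. [folklore] -/
theorem twistChar_zero (k : Fin 2 → ℤ) (c : 𝕋² → ℝ) (x : 𝕋²) : twistChar k c 0 x = mFourier (-k) x := by
  rw [twistChar, fourier_eval_coe_zero_mul, one_mul]

/-- At `s = 0` the twisted test field is `χ(0) e_{-k}`. [folklore] -/
theorem twistTest_zero (χ : ℝ → ℝ) (k : Fin 2 → ℤ) (c : 𝕋² → ℝ) (x : 𝕋²) :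
    twistTest χ k c 0 x = (χ 0 : ℂ) * mFourier (-k) x := by
  rw [twistTest, twistChar_zero]

/-- `‖Ψ(s, x)‖ = |χ(s)|`. [folklore] -/
theorem norm_twistTest (χ : ℝ → ℝ) (k : Fin 2 → ℤ) (c : 𝕋² → ℝ) (s : ℝ) (x : 𝕋²) :
    ‖twistTest χ k c s x‖ = |χ s| := by
  rw [twistTest, norm_mul, norm_twistChar, mul_one, Complex.norm_real, Real.norm_eq_abs]

/-- **Lipschitz dependence of the twisted character on the profile**:
`‖E_{k,c}(s,x) - E_{k,c'}(s,x)‖ ≤ 2π|k₁||s||c(x) - c'(x)|`. [folklore] -/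
theorem norm_twistChar_sub_le (k : Fin 2 → ℤ) (c c' : 𝕋² → ℝ) (s : ℝ) (x : 𝕋²) :
    ‖twistChar k c s x - twistChar k c' s x‖ ≤ 2 * π * |(k 0 : ℝ)| * |s| * |c x - c' x| := by
  rw [twistChar, twistChar, ← sub_mul, norm_mul, Literature.Analysis.FunctionSpaces.Torus.norm_mFourier_apply,
    mul_one]
  refine (norm_fourier_coe_sub_le (k 0) _ _).trans (le_of_eq ?_)
  rw [← mul_sub, abs_mul]
  ring

/-- **The character read along the inverse characteristic is the twisted character**:
`e_{-k}(x₁ - s v(x₂), x₂) = E_{k, v(x₂)}(s, x)` (`e_{-k}(x - a e₁) = e_{-k₁}(-a) e_{-k}(x)`,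
`Torus.mFourier_add_single`). [folklore] -/
theorem mFourier_neg_apply_skew (k : Fin 2 → ℤ) (v : UnitAddCircle → ℝ) (s : ℝ) (x : 𝕋²) :
    mFourier (-k) (![x 0 - ((s * v (x 1) : ℝ) : UnitAddCircle), x 1] : 𝕋²) =
      twistChar k (fun y => v (y 1)) s x := by
  have h : (![x 0 - ((s * v (x 1) : ℝ) : UnitAddCircle), x 1] : 𝕋²) =
      x + Pi.single 0 (-((s * v (x 1) : ℝ) : UnitAddCircle)) := by
    ext i; fin_cases i <;> simp [sub_eq_add_neg]
  rw [h, Literature.Analysis.FunctionSpaces.Torus.mFourier_add_single, twistChar, Pi.neg_apply,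
    fourier_neg_neg]

/-! ## Smoothness of the twisted test fields -/

/-- For smooth `χ` and a smooth profile `c`, the space–time lift of the twisted test field is
`C^∞` on `ℝ × ℝ²` (products and compositions of smooth maps; the characters are smooth,
`Torus.isSmooth_mFourier`). [folklore] -/
theorem contDiff_stLift_twistTest {χ : ℝ → ℝ} (hχ : ContDiff ℝ ∞ χ) (k : Fin 2 → ℤ) {c : 𝕋² → ℝ}
    (hc : Literature.Analysis.FunctionSpaces.Torus.IsSmooth c) :
    ContDiff ℝ ∞ (Literature.Analysis.FunctionSpaces.Torus.stLift (twistTest χ k c)) := by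
  have h : Literature.Analysis.FunctionSpaces.Torus.stLift (twistTest χ k c) =
      fun p : ℝ × EuclideanSpace ℝ (Fin 2) => (χ p.1 : ℂ) *
        (fourier (k 0) ((p.1 * Literature.Analysis.FunctionSpaces.Torus.lift c p.2 : ℝ) : UnitAddCircle) *
          Literature.Analysis.FunctionSpaces.Torus.lift (⇑(mFourier (-k))) p.2) := by
    funext p; rfl
  rw [h]
  refine (Complex.ofRealCLM.contDiff.comp (hχ.comp contDiff_fst)).mul (ContDiff.mul ?_ ?_)
  · exact (contDiff_fourier_coe (k 0)).comp (contDiff_fst.mul (hc.comp contDiff_snd))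
  · exact (Literature.Analysis.FunctionSpaces.Torus.isSmooth_mFourier (-k)).comp contDiff_snd

/-- For smooth `χ` vanishing on `[T', ∞)`, `T' < T`, and a smooth profile, the twisted test field
is a (complex-valued) space–time test field on `T² × [0,T)`. [folklore] -/
theorem isSpaceTimeTest_twistTest {T : ℝ} {χ : ℝ → ℝ} (hχ : ContDiff ℝ ∞ χ)
    (hχT : ∃ T' < T, ∀ t, T' ≤ t → χ t = 0) (k : Fin 2 → ℤ) {c : 𝕋² → ℝ}
    (hc : Literature.Analysis.FunctionSpaces.Torus.IsSmooth c) :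
    Literature.Analysis.FunctionSpaces.Torus.IsSpaceTimeTest T (twistTest χ k c) := by
  obtain ⟨T', hT', h0⟩ := hχT
  refine ⟨contDiff_stLift_twistTest hχ k hc, T', hT', fun t ht => ?_⟩
  funext x
  simp [twistTest, h0 t ht]

/-- Post-composition with a continuous linear map preserves space–time test fields (e.g. real
and imaginary parts of a complex test field); dot-notation extension of the accepted
`Torus.IsSpaceTimeTest`, declared with its absolute name. [folklore] -/
theorem _root_.Literature.Analysis.FunctionSpaces.Torus.IsSpaceTimeTest.clm_comp {d : Type*}
    [Fintype d] {F G : Type*} [NormedAddCommGroup F] [NormedSpace ℝ F] [NormedAddCommGroup G] [NormedSpace ℝ G]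
    {T : ℝ} {ψ : ℝ → UnitAddTorus d → F}
    (hψ : Literature.Analysis.FunctionSpaces.Torus.IsSpaceTimeTest T ψ) (L : F →L[ℝ] G) :
    Literature.Analysis.FunctionSpaces.Torus.IsSpaceTimeTest T (fun t x => L (ψ t x)) := by
  obtain ⟨hs, T', hT', h0⟩ := hψ
  refine ⟨L.contDiff.comp hs, T', hT', fun t ht => ?_⟩
  funext x
  simp [h0 t ht]

/-- The real part of the twisted test field is a real space–time test field. [folklore] -/
theorem isSpaceTimeTest_twistTest_re {T : ℝ} {χ : ℝ → ℝ} (hχ : ContDiff ℝ ∞ χ)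
    (hχT : ∃ T' < T, ∀ t, T' ≤ t → χ t = 0) (k : Fin 2 → ℤ) {c : 𝕋² → ℝ}
    (hc : Literature.Analysis.FunctionSpaces.Torus.IsSmooth c) :
    Literature.Analysis.FunctionSpaces.Torus.IsSpaceTimeTest T (fun s x => (twistTest χ k c s x).re) :=
  (isSpaceTimeTest_twistTest hχ hχT k hc).clm_comp Complex.reCLM

/-- The imaginary part of the twisted test field is a real space–time test field. [folklore] -/
theorem isSpaceTimeTest_twistTest_im {T : ℝ} {χ : ℝ → ℝ} (hχ : ContDiff ℝ ∞ χ)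
    (hχT : ∃ T' < T, ∀ t, T' ≤ t → χ t = 0) (k : Fin 2 → ℤ) {c : 𝕋² → ℝ}
    (hc : Literature.Analysis.FunctionSpaces.Torus.IsSmooth c) :
    Literature.Analysis.FunctionSpaces.Torus.IsSpaceTimeTest T (fun s x => (twistTest χ k c s x).im) :=
  (isSpaceTimeTest_twistTest hχ hχT k hc).clm_comp Complex.imCLM

/-! ## Derivatives of the twisted test fields -/

/-- **Time derivative of the twisted test field**:
`∂ₛ Ψ(s,x) = χ'(s) E(s,x) + χ(s) · 2πi k₁ c(x) E(s,x)`. [folklore] -/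
theorem hasDerivAt_twistTest {χ : ℝ → ℝ} (hχ : Differentiable ℝ χ) (k : Fin 2 → ℤ) (c : 𝕋² → ℝ)
    (s : ℝ) (x : 𝕋²) :
    HasDerivAt (fun τ => twistTest χ k c τ x)
      (((deriv χ s : ℝ) : ℂ) * twistChar k c s x +
        (χ s : ℂ) * (2 * π * I * (k 0) * (c x : ℝ) * twistChar k c s x)) s := by
  have h1 : HasDerivAt (fun τ : ℝ => ((χ τ : ℝ) : ℂ)) ((deriv χ s : ℝ) : ℂ) s :=
    (hχ s).hasDerivAt.ofReal_comp
  have h2 : HasDerivAt (fun τ : ℝ => fourier (k 0) (((τ * c x : ℝ)) : UnitAddCircle))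
      ((c x : ℂ) * (2 * π * I * (k 0) * fourier (k 0) (((s * c x : ℝ)) : UnitAddCircle))) s := by
    have hid : HasDerivAt (fun τ : ℝ => τ * c x) (c x) s := by
      simpa using (hasDerivAt_id s).mul_const (c x)
    have h := (hasDerivAt_fourier_coe (k 0) (s * c x)).scomp s hid
    rw [Complex.real_smul] at h
    exact h
  have h3 : HasDerivAt (fun τ : ℝ => twistChar k c τ x)
      ((c x : ℂ) * (2 * π * I * (k 0) * fourier (k 0) (((s * c x : ℝ)) : UnitAddCircle)) * mFourier (-k) x) s :=
    h2.mul_const _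
  have h4 := h1.mul h3
  refine h4.congr_deriv ?_
  simp only [twistChar]
  ring

/-- `∂ₛ Ψ = (χ' + χ · 2πi k₁ c) E`, in terms of `Torus.timeDeriv`. [folklore] -/
theorem timeDeriv_twistTest {χ : ℝ → ℝ} (hχ : Differentiable ℝ χ) (k : Fin 2 → ℤ) (c : 𝕋² → ℝ)
    (s : ℝ) (x : 𝕋²) :
    Literature.Analysis.FunctionSpaces.Torus.timeDeriv (twistTest χ k c) s x =
      (((deriv χ s : ℝ) : ℂ) + (χ s : ℂ) * (2 * π * I * (k 0) * (c x : ℝ))) * twistChar k c s x := by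
  rw [Literature.Analysis.FunctionSpaces.Torus.timeDeriv, (hasDerivAt_twistTest hχ k c s x).deriv]
  ring

/-- Time derivative of the real part: `∂ₛ Re Ψ = Re ∂ₛ Ψ`. [folklore] -/
theorem timeDeriv_twistTest_re {χ : ℝ → ℝ} (hχ : Differentiable ℝ χ) (k : Fin 2 → ℤ) (c : 𝕋² → ℝ)
    (s : ℝ) (x : 𝕋²) :
    Literature.Analysis.FunctionSpaces.Torus.timeDeriv (fun τ y => (twistTest χ k c τ y).re) s x =
      ((((deriv χ s : ℝ) : ℂ) + (χ s : ℂ) * (2 * π * I * (k 0) * (c x : ℝ))) * twistChar k c s x).re := by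
  rw [← timeDeriv_twistTest hχ k c s x, Literature.Analysis.FunctionSpaces.Torus.timeDeriv,
    Literature.Analysis.FunctionSpaces.Torus.timeDeriv]
  exact (Complex.reCLM.hasFDerivAt.comp_hasDerivAt s (hasDerivAt_twistTest hχ k c s x)).deriv.trans
    (by rw [(hasDerivAt_twistTest hχ k c s x).deriv]; rfl)

/-- Time derivative of the imaginary part: `∂ₛ Im Ψ = Im ∂ₛ Ψ`. [folklore] -/
theorem timeDeriv_twistTest_im {χ : ℝ → ℝ} (hχ : Differentiable ℝ χ) (k : Fin 2 → ℤ) (c : 𝕋² → ℝ)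
    (s : ℝ) (x : 𝕋²) :
    Literature.Analysis.FunctionSpaces.Torus.timeDeriv (fun τ y => (twistTest χ k c τ y).im) s x =
      ((((deriv χ s : ℝ) : ℂ) + (χ s : ℂ) * (2 * π * I * (k 0) * (c x : ℝ))) * twistChar k c s x).im := by
  rw [← timeDeriv_twistTest hχ k c s x, Literature.Analysis.FunctionSpaces.Torus.timeDeriv,
    Literature.Analysis.FunctionSpaces.Torus.timeDeriv]
  exact (Complex.imCLM.hasFDerivAt.comp_hasDerivAt s (hasDerivAt_twistTest hχ k c s x)).deriv.trans
    (by rw [(hasDerivAt_twistTest hχ k c s x).deriv]; rfl)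

/-- The covering map on a coordinate line: `proj (t eⱼ) = t eⱼ (mod 1)`. [folklore] -/
theorem proj_smul_single (t : ℝ) (j : Fin 2) :
    Literature.Analysis.FunctionSpaces.Torus.proj (t • EuclideanSpace.single j (1 : ℝ)) =
      (Pi.single j (t : UnitAddCircle) : 𝕋²) := by
  funext i
  rw [Literature.Analysis.FunctionSpaces.Torus.proj_smul_apply]
  by_cases h : i = j
  · subst h; simp
  · simp [h]

/-- **Derivative of the twisted test field along the first axis**, for a profile `c` that does
not depend on `x₁`: `∂_{x₁} Ψ(s,x) = -2πi k₁ Ψ(s,x)` (along `x + t e₁` only the character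
`e_{-k}` moves, `e_{-k}(x + t e₁) = e_{-k₁}(t) e_{-k}(x)`). [folklore] -/
theorem hasDerivAt_twistTest_line {χ : ℝ → ℝ} (k : Fin 2 → ℤ) {c : 𝕋² → ℝ}
    (hc0 : ∀ (r : UnitAddCircle) (x : 𝕋²), c (x + Pi.single 0 r) = c x) (s : ℝ) (x : 𝕋²) :
    HasDerivAt (fun t : ℝ => twistTest χ k c s
        (x + Literature.Analysis.FunctionSpaces.Torus.proj (t • EuclideanSpace.single 0 (1 : ℝ))))
      (-(2 * π * I * (k 0)) * twistTest χ k c s x) 0 := by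
  have h : (fun t : ℝ => twistTest χ k c s
      (x + Literature.Analysis.FunctionSpaces.Torus.proj (t • EuclideanSpace.single 0 (1 : ℝ)))) =
      fun t : ℝ => twistTest χ k c s x * fourier (-k 0) (t : UnitAddCircle) := by
    funext t
    rw [proj_smul_single, twistTest, twistTest, twistChar, twistChar, hc0,
      Literature.Analysis.FunctionSpaces.Torus.mFourier_add_single, Pi.neg_apply]
    ring
  rw [h]
  have hd := (hasDerivAt_fourier_coe (-k 0) 0).const_mul (twistTest χ k c s x)
  refine hd.congr_deriv ?_
  simp only [QuotientAddGroup.mk_zero, fourier_eval_zero, mul_one, Int.cast_neg]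
  ring

/-- `∂₁ Ψ = -2πi k₁ Ψ` for an `x₁`-independent profile (`Torus.partialDeriv 0`). [folklore] -/
theorem partialDeriv_twistTest {χ : ℝ → ℝ} (k : Fin 2 → ℤ) {c : 𝕋² → ℝ}
    (hc0 : ∀ (r : UnitAddCircle) (x : 𝕋²), c (x + Pi.single 0 r) = c x) (s : ℝ) (x : 𝕋²) :
    Literature.Analysis.FunctionSpaces.Torus.partialDeriv 0 (twistTest χ k c s) x =
      -(2 * π * I * (k 0)) * twistTest χ k c s x :=
  (hasDerivAt_twistTest_line k hc0 s x).deriv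

/-- `∂₁ Re Ψ = Re(-2πi k₁ Ψ)` for an `x₁`-independent profile. [folklore] -/
theorem partialDeriv_twistTest_re {χ : ℝ → ℝ} (k : Fin 2 → ℤ) {c : 𝕋² → ℝ}
    (hc0 : ∀ (r : UnitAddCircle) (x : 𝕋²), c (x + Pi.single 0 r) = c x) (s : ℝ) (x : 𝕋²) :
    Literature.Analysis.FunctionSpaces.Torus.partialDeriv 0 (fun y => (twistTest χ k c s y).re) x =
      (-(2 * π * I * (k 0)) * twistTest χ k c s x).re :=
  (Complex.reCLM.hasFDerivAt.comp_hasDerivAt (0 : ℝ) (hasDerivAt_twistTest_line k hc0 s x)).deriv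

/-- `∂₁ Im Ψ = Im(-2πi k₁ Ψ)` for an `x₁`-independent profile. [folklore] -/
theorem partialDeriv_twistTest_im {χ : ℝ → ℝ} (k : Fin 2 → ℤ) {c : 𝕋² → ℝ}
    (hc0 : ∀ (r : UnitAddCircle) (x : 𝕋²), c (x + Pi.single 0 r) = c x) (s : ℝ) (x : 𝕋²) :
    Literature.Analysis.FunctionSpaces.Torus.partialDeriv 0 (fun y => (twistTest χ k c s y).im) x =
      (-(2 * π * I * (k 0)) * twistTest χ k c s x).im :=
  (Complex.imCLM.hasFDerivAt.comp_hasDerivAt (0 : ℝ) (hasDerivAt_twistTest_line k hc0 s x)).deriv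


/-! ## The transport operator applied to the twisted test fields -/

/-- The time slices of the twisted test field are smooth on `T²`. [folklore] -/
theorem isSmooth_twistTest_slice {χ : ℝ → ℝ} (hχ : ContDiff ℝ ∞ χ) (k : Fin 2 → ℤ) {c : 𝕋² → ℝ}
    (hc : Literature.Analysis.FunctionSpaces.Torus.IsSmooth c) (s : ℝ) :
    Literature.Analysis.FunctionSpaces.Torus.IsSmooth (twistTest χ k c s) :=
  (contDiff_stLift_twistTest hχ k hc).comp (contDiff_prodMk_right s)

/-- The time slices of `Re Ψ` are smooth on `T²`. [folklore] -/
theorem isSmooth_twistTest_slice_re {χ : ℝ → ℝ} (hχ : ContDiff ℝ ∞ χ) (k : Fin 2 → ℤ) {c : 𝕋² → ℝ}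
    (hc : Literature.Analysis.FunctionSpaces.Torus.IsSmooth c) (s : ℝ) :
    Literature.Analysis.FunctionSpaces.Torus.IsSmooth fun y => (twistTest χ k c s y).re :=
  (isSmooth_twistTest_slice hχ k hc s).comp_clm Complex.reCLM

/-- The time slices of `Im Ψ` are smooth on `T²`. [folklore] -/
theorem isSmooth_twistTest_slice_im {χ : ℝ → ℝ} (hχ : ContDiff ℝ ∞ χ) (k : Fin 2 → ℤ) {c : 𝕋² → ℝ}
    (hc : Literature.Analysis.FunctionSpaces.Torus.IsSmooth c) (s : ℝ) :
    Literature.Analysis.FunctionSpaces.Torus.IsSmooth fun y => (twistTest χ k c s y).im :=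
  (isSmooth_twistTest_slice hχ k hc s).comp_clm Complex.imCLM

/-- **The transport operator of Lemma 4 applied to the real twisted test field.** For smooth
`χ`, a smooth `x₁`-independent profile `c` and any `v : T → ℝ`,
`(∂ₛ + v(x₂)∂₁) Re Ψ(s,x) = Re[(χ'(s) + χ(s) · 2πi k₁ (c(x) - v(x₂))) E_{k,c}(s,x)]`: the twist
cancels the transport up to the profile error `c - v(x₂)` — exactly for `c = v(x₂)` the test
field would be constant along the characteristics, but `v ∈ L²` is not smooth, whence the
approximation by smooth `c` in the uniqueness proof. The left side is written as the integrand
`∂ₜψ + ⟪u, ∇ψ⟫ + 0·Δψ` of the accepted `Torus.IsWeakScalarTransportOn` with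
`u = shearVelocity v`. [folklore] -/
theorem transport_twistTest_re {χ : ℝ → ℝ} (hχ : ContDiff ℝ ∞ χ) (k : Fin 2 → ℤ) {c : 𝕋² → ℝ}
    (hc : Literature.Analysis.FunctionSpaces.Torus.IsSmooth c)
    (hc0 : ∀ (r : UnitAddCircle) (x : 𝕋²), c (x + Pi.single 0 r) = c x) (v : UnitAddCircle → ℝ)
    (s : ℝ) (x : 𝕋²) :
    Literature.Analysis.FunctionSpaces.Torus.timeDeriv (fun τ y => (twistTest χ k c τ y).re) s x +
        ⟪shearVelocity v s x,
          Literature.Analysis.FunctionSpaces.Torus.gradient (fun y => (twistTest χ k c s y).re) x⟫_ℝ +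
        0 * Literature.Analysis.FunctionSpaces.Torus.laplacian (fun y => (twistTest χ k c s y).re) x =
      ((((deriv χ s : ℝ) : ℂ) + (χ s : ℂ) * (2 * π * I * (k 0) * ((c x - v (x 1) : ℝ) : ℂ))) *
        twistChar k c s x).re := by
  rw [zero_mul, add_zero, inner_shearVelocity_gradient v
      ((isSmooth_twistTest_slice_re hχ k hc s).isContDiff (by simp)) s x,
    timeDeriv_twistTest_re (hχ.differentiable (by simp)) k c s x, partialDeriv_twistTest_re k hc0 s x,
    ← Complex.re_ofReal_mul, ← Complex.add_re]
  congr 1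
  simp only [twistTest]
  push_cast
  ring

/-- **The transport operator of Lemma 4 applied to the imaginary twisted test field**:
`(∂ₛ + v(x₂)∂₁) Im Ψ = Im[(χ' + χ · 2πi k₁ (c - v(x₂))) E_{k,c}]`. [folklore] -/
theorem transport_twistTest_im {χ : ℝ → ℝ} (hχ : ContDiff ℝ ∞ χ) (k : Fin 2 → ℤ) {c : 𝕋² → ℝ}
    (hc : Literature.Analysis.FunctionSpaces.Torus.IsSmooth c)
    (hc0 : ∀ (r : UnitAddCircle) (x : 𝕋²), c (x + Pi.single 0 r) = c x) (v : UnitAddCircle → ℝ)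
    (s : ℝ) (x : 𝕋²) :
    Literature.Analysis.FunctionSpaces.Torus.timeDeriv (fun τ y => (twistTest χ k c τ y).im) s x +
        ⟪shearVelocity v s x,
          Literature.Analysis.FunctionSpaces.Torus.gradient (fun y => (twistTest χ k c s y).im) x⟫_ℝ +
        0 * Literature.Analysis.FunctionSpaces.Torus.laplacian (fun y => (twistTest χ k c s y).im) x =
      ((((deriv χ s : ℝ) : ℂ) + (χ s : ℂ) * (2 * π * I * (k 0) * ((c x - v (x 1) : ℝ) : ℂ))) *
        twistChar k c s x).im := by
  rw [zero_mul, add_zero, inner_shearVelocity_gradient v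
      ((isSmooth_twistTest_slice_im hχ k hc s).isContDiff (by simp)) s x,
    timeDeriv_twistTest_im (hχ.differentiable (by simp)) k c s x, partialDeriv_twistTest_im k hc0 s x,
    ← Complex.im_ofReal_mul, ← Complex.add_im]
  congr 1
  simp only [twistTest]
  push_cast
  ring

end Literature.Barriers.AnomalousDissipation

end
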